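import Literature.Analysis.FluidPDE.FiniteFourierModeEulerPolygonB

/-!
# The periodic vertex chain around a face polygon

Support file for `FiniteFourierModeEuler` (N. Kishimoto, T. Yoneda, J. Math. Fluid Mech. 24
(2022) 74 = arXiv:2110.08039). The boundary polygon `q₀ = p₀, q₁, …, q_m` of a face of `S^{conv}`
(`FaceCfg.poly`, `FiniteFourierModeEulerPolygonB`) is read periodically,
`p₀ = q₀, q₁, …, q_m, q₀, q₁, …` (`chain`); this bookkeeping is shared by the three-dimensional
argument at the vertex of maximal length (`FiniteFourierModeEulerKeyA`, Props. 4.4 (iv)/4.7) and by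
the boundary polygon of a planar support (`FiniteFourierModeEulerPlanarPolyA`, §3).

## References

* [KishimotoYoneda2022] N. Kishimoto, T. Yoneda, J. Math. Fluid Mech. 24 (2022) 74 =
  arXiv:2110.08039, §3 and §4 (the boundary polygons `∂F` of the faces of `S^{conv}`).
-/

noncomputable section

open Matrix Set Finset

namespace Literature.Analysis.FluidPDE

namespace KY

/-! ### The periodic chain around the boundary polygon -/

section Chain

variable {S : Finset (Fin 3 → ℝ)} {φ p₀ : Fin 3 → ℝ}

/-- The `(m+1)`-periodic vertex chain `p₀ = q₀, q₁, …, q_m, q₀, q₁, …`. [folklore] -/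
def chain (S : Finset (Fin 3 → ℝ)) (φ p₀ : Fin 3 → ℝ) (j : ℕ) : Fin 3 → ℝ :=
  FaceCfg.poly S φ p₀ 1 (j % (FaceCfg.nverts S φ p₀ 1 + 1))

/-- Periodicity of the chain. [folklore] -/
theorem chain_periodic (j : ℕ) : chain S φ p₀ (j + (FaceCfg.nverts S φ p₀ 1 + 1)) = chain S φ p₀ j := by
  unfold chain; rw [Nat.add_mod_right]

/-- The chain on the first period. [folklore] -/
theorem chain_of_le {j : ℕ} (hj : j ≤ FaceCfg.nverts S φ p₀ 1) : chain S φ p₀ j = FaceCfg.poly S φ p₀ 1 j := by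
  unfold chain; rw [Nat.mod_eq_of_lt (Nat.lt_succ_of_le hj)]

/-- `chain (m+1) = q₀`. [folklore] -/
theorem chain_succ_nverts : chain S φ p₀ (FaceCfg.nverts S φ p₀ 1 + 1) = FaceCfg.poly S φ p₀ 1 0 := by
  unfold chain; rw [Nat.mod_self]

/-- `chain (m+2) = q₁` (`m ≥ 1`). [folklore] -/
theorem chain_nverts_add_two (hm : 1 ≤ FaceCfg.nverts S φ p₀ 1) :
    chain S φ p₀ (FaceCfg.nverts S φ p₀ 1 + 2) = FaceCfg.poly S φ p₀ 1 1 := by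
  unfold chain
  rw [show FaceCfg.nverts S φ p₀ 1 + 2 = 1 + (FaceCfg.nverts S φ p₀ 1 + 1) by ring, Nat.add_mod_right,
    Nat.mod_eq_of_lt (by omega)]

/-- Consecutive chain points are consecutive polygon points `q_{j'}, q_{j'+1}`, `j' ≤ m`
(with `q_{m+1} = q₀`). [folklore] -/
theorem chain_consecutive (j : ℕ) : ∃ j' : ℕ, j' ≤ FaceCfg.nverts S φ p₀ 1 ∧
    chain S φ p₀ j = FaceCfg.poly S φ p₀ 1 j' ∧ chain S φ p₀ (j + 1) = FaceCfg.poly S φ p₀ 1 (j' + 1) := by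
  have hj'le : j % (FaceCfg.nverts S φ p₀ 1 + 1) ≤ FaceCfg.nverts S φ p₀ 1 :=
    Nat.lt_succ_iff.1 (Nat.mod_lt _ (Nat.succ_pos _))
  refine ⟨j % (FaceCfg.nverts S φ p₀ 1 + 1), hj'le, rfl, ?_⟩
  unfold chain
  rcases hj'le.lt_or_eq with hlt | heq
  · congr 1
    rw [Nat.add_mod, Nat.one_mod_eq_one.2 (by omega), Nat.mod_eq_of_lt (by omega)]
  · have hdm := Nat.div_add_mod j (FaceCfg.nverts S φ p₀ 1 + 1)
    rw [heq] at hdm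
    have hj1 : j + 1 = (FaceCfg.nverts S φ p₀ 1 + 1)
        + (FaceCfg.nverts S φ p₀ 1 + 1) * (j / (FaceCfg.nverts S φ p₀ 1 + 1)) := by omega
    rw [hj1, Nat.add_mul_mod_self_left, Nat.mod_self, heq, FaceCfg.poly_zero,
      FaceCfg.poly_of_gt (Nat.lt_succ_self _)]

end Chain

end KY

end Literature.Analysis.FluidPDE
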